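import Literature.Analysis.FluidPDE.PassiveScalarDiagMildUndamp
import Literature.Analysis.FluidPDE.PassiveScalarDiagUniqueness
import HarnessLib

/-!
# Existence of strongly `L²`-continuous weak solutions of the passive scalar equation with constant
  diagonal diffusion and bounded drift on `T^d`

Analysis/FluidPDE proof file (everything proved): the `T2` item of the diagonal parabolic layer behind
Hess-Childs–Rowan's universal total dissipator on the flat torus `[0,√2]×[0,1]`
(`AcceleratingDissipationEnhancement`, `UniversalTotalAnomalousDissipator`: on the unit torus the
isotropic `κΔ` becomes `κ(½∂₀∂₀ + ∂₁∂₁)`).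

**Main theorem** `Torus.exists_isWeakScalarTransportDiagOn_l2Continuous`: for `κ > 0`, `aᵢ > 0`,
`θ₀ ∈ L²(T^d)` and a bounded measurable velocity `u ∈ L^∞((0,T) × T^d)` weakly divergence free at
a.e. time, there is a weak solution `θ` of `∂ₜθ + u·∇θ = κ∑ᵢaᵢ∂ᵢ∂ᵢθ` on `T^d × [0,T)` with datum `θ₀`
(`Torus.IsWeakScalarTransportDiagOn T a κ u θ₀ θ`) which is the `L²`-continuous representative on
`[0,T]` (`Torus.IsL2ContinuousOn (Icc 0 T) θ`, STRONG continuity) with `θ 0 = θ₀`; isotropic corollary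
`Torus.exists_isWeakScalarTransportOn_l2Continuous` (the tree's `exists_isWeakScalarTransportOn`
upgraded by the continuous representative). The solution is the MILD solution of the sequence
`PassiveScalarDiagMild*` (Duhamel fixed point in `L^∞_t ℓ²_k` after exponential damping, Pazy 1983
Ch. 4 §4.2 / Ch. 6 Thm. 1.2; synthesis by the parametrised Riesz–Fischer theorem; weak formulation
mode by mode; strong continuity by uniform tail control), with the slice `t = 0` set equal to `θ₀`
(`𝓕(θ(0)) = θ̂₀`), and the constant field in the degenerate cases `T ≤ 0`, `d = ∅`.

Also: EVERY weak solution in this class (bounded drift) has such a representative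
(`IsWeakScalarTransportDiagOn.exists_l2Continuous_representative`, by the tree's bounded-drift uniqueness
`Torus.IsWeakScalarTransportDiagOn.ae_eq_of_memLp_top` of `PassiveScalarDiagUniqueness`).

What is NOT here: the energy (in)equality in this class (the `T1` item), restart and traces (the `T3`
item), the drift-free Fourier representation (`T4`).

## References

* A. Pazy, *Semigroups of Linear Operators and Applications to PDE*, Springer 1983, Ch. 4 §4.2
  (mild solutions, (2.3), Def. 2.3), Ch. 6 §6.1 Thm. 1.2 (Picard iteration for the mild equation).
* R. J. DiPerna, P.-L. Lions, Invent. Math. 98 (1989) 511–547, §II.1. L. C. Evans, *PDE* (2010), §7.1.2.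
* L. Grafakos, *Classical Fourier Analysis*, 3rd ed. (2014), Prop. 3.2.6 (4), (8), Prop. 3.2.7 (3), §3.3.1.
* J. C. Robinson, J. L. Rodrigo, W. Sadowski, *The Three-Dimensional Navier–Stokes Equations* (2016), Thm. 4.11.
-/

noncomputable section

open MeasureTheory TopologicalSpace Set Function Filter UnitAddTorus
open _root_.Topology
open scoped ENNReal NNReal InnerProductSpace ComplexConjugate

namespace Literature.Analysis.FluidPDE

namespace Torus

open Literature.Analysis.FunctionSpaces.Torus Literature.Analysis.FunctionSpaces

variable {d : Type*} [Fintype d]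

section Existence

variable [DecidableEq d]
variable {T U E κ : ℝ} {a : d → ℝ} {u : ℝ → UnitAddTorus d → EuclideanSpace ℝ d}
  {θ : ℝ → UnitAddTorus d → ℝ} {θ₀ : UnitAddTorus d → ℝ}

/-! ### Modification at `t = 0` and the degenerate cases -/

/-- **Modification on `(0,T)`-invisible times**: a field agreeing with a weak solution at every
`t ∈ (0,T)` is a weak solution with the same drift and datum (every clause of the weak class is an
integral over `(0,T)` or an a.e. statement there). [cite: DiPernaLions1989, §II.1 (12)–(14)] -/
theorem IsWeakScalarTransportDiagOn.congr_Ioo {θ' : ℝ → UnitAddTorus d → ℝ}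
    (h : IsWeakScalarTransportDiagOn T a κ u θ₀ θ) (heq : ∀ t ∈ Ioo 0 T, θ' t = θ t) :
    IsWeakScalarTransportDiagOn T a κ u θ₀ θ' := by
  obtain ⟨C, hC⟩ := h.ae_lintegral_sq_le
  have hae : ∀ᵐ t ∂((volume : Measure ℝ).restrict (Ioo 0 T)), θ' t = θ t :=
    (ae_restrict_mem measurableSet_Ioo).mono heq
  refine ⟨?_, h.aestronglyMeasurable_velocity, ⟨C, ?_⟩, h.lintegral_velocity_lt_top, ?_, h.ae_isWeaklyDivFree,
    fun ψ hψ => ?_⟩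
  · refine h.aestronglyMeasurable.congr ?_
    filter_upwards [ae_restrict_mem (measurableSet_Ioo.prod MeasurableSet.univ)] with p hp
    simp only [stLift]
    rw [heq p.1 (Set.mem_prod.1 hp).1]
  · filter_upwards [hC, hae] with t ht hte
    rw [hte]; exact ht
  · have e : ∫⁻ t in Ioo 0 T, ∫⁻ x, ‖u t x‖ₑ * ‖θ' t x‖ₑ = ∫⁻ t in Ioo 0 T, ∫⁻ x, ‖u t x‖ₑ * ‖θ t x‖ₑ :=
      setLIntegral_congr_fun measurableSet_Ioo fun t ht => by rw [heq t ht]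
    rw [e]; exact h.lintegral_mul_lt_top
  · have e : (∫ t in Ioo 0 T, ∫ x, θ' t x *
        (FunctionSpaces.Torus.timeDeriv ψ t x + ⟪u t x, FunctionSpaces.Torus.gradient (ψ t) x⟫_ℝ +
          κ * ∑ i, a i * FunctionSpaces.Torus.partialDeriv i (FunctionSpaces.Torus.partialDeriv i (ψ t)) x)) =
        ∫ t in Ioo 0 T, ∫ x, θ t x *
        (FunctionSpaces.Torus.timeDeriv ψ t x + ⟪u t x, FunctionSpaces.Torus.gradient (ψ t) x⟫_ℝ +
          κ * ∑ i, a i * FunctionSpaces.Torus.partialDeriv i (FunctionSpaces.Torus.partialDeriv i (ψ t)) x) :=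
      setIntegral_congr_fun measurableSet_Ioo fun t ht => by rw [heq t ht]
    rw [e]; exact h.weak_eq ψ hψ

omit [DecidableEq d] in
/-- **Modification by a.e.-equal slices preserves strong `L²` continuity.** [cite: Grafakos2014, Prop. 3.2.7 (3)] -/
theorem IsL2ContinuousOn.congr_ae_slice {S : Set ℝ} {θ θ' : ℝ → UnitAddTorus d → ℝ} (h : IsL2ContinuousOn S θ)
    (hae : ∀ t ∈ S, θ' t =ᵐ[volume] θ t) :
    IsL2ContinuousOn S θ' := by
  refine ⟨fun t ht => (h.1 t ht).ae_eq (hae t ht).symm, fun t₀ ht₀ => ?_⟩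
  refine ((h.2 t₀ ht₀).congr' ?_)
  filter_upwards [self_mem_nhdsWithin] with t ht
  refine integral_congr_ae ?_
  filter_upwards [hae t ht, hae t₀ ht₀] with x hx hx₀
  simp only [Pi.sub_apply, hx, hx₀]

variable [Nonempty d]

/-- **Existence of a strongly `L²`-continuous weak solution, `T > 0`, positive dimension.** For
`κ > 0`, `aᵢ > 0`, a bounded measurable drift on `(0,T) × T^d`, weakly divergence free at a.e.
time, and `θ₀ ∈ L²(T^d)`, there is a weak solution of `∂ₜθ + u·∇θ = κ∑ᵢaᵢ∂ᵢ∂ᵢθ` on `T^d × [0,T)`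
with datum `θ₀` (`Torus.IsWeakScalarTransportDiagOn`) which is the `L²`-continuous representative on
`[0,T]` (`Torus.IsL2ContinuousOn`) with `θ(0) = θ₀`, and `∫ θ(t)² ≤ 4 e^{2λT} ∫ θ₀²`,
`λ = 2(∑ⱼaⱼ⁻¹)U²/κ + 1` — the mild solution (Pazy 1983, Ch. 4 §4.2, Ch. 6 Thm. 1.2) of the
present files. [cite: Pazy1983, Ch. 4 §4.2 Def. 2.3 and Ch. 6 §6.1 Thm. 1.2, pp. 106, 184] -/
theorem exists_isWeakScalarTransportDiagOn_of_pos (hT : 0 < T) (hκ : 0 < κ) (ha : ∀ i, 0 < a i)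
    (hθ₀ : MemLp θ₀ 2 volume) (hu : MemLp (stLift u) ∞ (volume.restrict (Ioo 0 T ×ˢ univ)))
    (hdiv : ∀ᵐ t ∂((volume : Measure ℝ).restrict (Ioo 0 T)), FunctionSpaces.Torus.IsWeaklyDivFree (u t)) :
    ∃ θ : ℝ → UnitAddTorus d → ℝ, IsWeakScalarTransportDiagOn T a κ u θ₀ θ ∧
      IsL2ContinuousOn (Icc 0 T) θ ∧ θ 0 = θ₀ := by
  obtain ⟨U, hU⟩ := DriftBound.of_memLp_top hu
  set P : MildData d := MildData.ofDrift hT hκ ha hU hθ₀ with hP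
  obtain ⟨θ, hθ, hcont, hmild⟩ := P.exists_mildSolution
  have hsol : IsWeakScalarTransportDiagOn T a κ u θ₀ θ :=
    isWeakScalarTransportDiagOn_of_mild (κ := κ) (a := a) hT hκ.le ha hu hU hdiv hθ hθ₀ hcont hmild
  -- the mild solution is `e^{λt} w` for the damped fixed point; its tails are uniformly small
  obtain ⟨w, hw, hwc, hweq⟩ := P.exists_dampedMildSolution
  -- NOTE: `exists_mildSolution` is built from SOME damped solution; we rebuild `θ` from this `w` to share it
  clear hsol hcont hmild hθ θ
  set θ := P.undamp w with hθdef
  have hθ : IsL2Field T (Real.exp (P.lam * P.T) ^ 2 * P.B ^ 2) θ := by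
    refine hw.mul_continuous (f := fun t => Real.exp (P.lam * t)) (by fun_prop) fun t ht => ?_
    exact pow_le_pow_left₀ (Real.exp_pos _).le (Real.exp_le_exp.2
      (mul_le_mul_of_nonneg_left ht.2 P.hlam.le)) 2
  have hcont : ∀ k, ContinuousOn (fun t => mFourierCoeff (fun x => (θ t x : ℂ)) k) (Icc 0 T) := by
    intro k
    have h : ContinuousOn (fun t => ((Real.exp (P.lam * t) : ℝ) : ℂ) * mFourierCoeff (fun x => (w t x : ℂ)) k)
        (Icc 0 P.T) := (Complex.continuous_ofReal.comp (by fun_prop)).continuousOn.mul (hwc k)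
    exact h.congr fun t _ => P.mFourierCoeff_undamp w t k
  have hmild : ∀ t ∈ Icc 0 T, ∀ k, mFourierCoeff (fun x => (θ t x : ℂ)) k = mildMap κ a 0 u θ₀ θ t k := by
    intro t ht k
    have e1 : P.lam * t + -((diagRate P.κ P.a k + P.lam) * t) = -(diagRate κ a k * t) := by
      show P.lam * t + -((diagRate κ a k + P.lam) * t) = -(diagRate κ a k * t)
      ring
    rw [hθdef, P.mFourierCoeff_undamp w t k, hweq t ht k, mildMap_apply, mildMap_apply, mul_sub, ← mul_assoc,
      ← Complex.ofReal_mul, ← Real.exp_add, add_zero, e1]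
    show _ = _ - duhamelCoeff κ a 0 u (fun t x => Real.exp (P.lam * t) * w t x) t k
    rw [duhamelCoeff_zero_exp_mul]
    rfl
  have hsol : IsWeakScalarTransportDiagOn T a κ u θ₀ θ :=
    isWeakScalarTransportDiagOn_of_mild (κ := κ) (a := a) hT hκ.le ha hu hU hdiv hθ hθ₀ hcont hmild
  have hL2 : IsL2ContinuousOn (Icc 0 T) θ :=
    isL2ContinuousOn_of_coeff hθ hcont fun ε hε => P.undamp_tail hw hweq hε
  have h0 : θ 0 =ᵐ[volume] θ₀ := P.ae_eq_datum_of_mild hθ hmild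
  -- replace the slice `t = 0` by `θ₀`
  set θ' : ℝ → UnitAddTorus d → ℝ := fun t => if t = 0 then θ₀ else θ t with hθ'
  have hθ't : ∀ {t : ℝ}, t ≠ 0 → θ' t = θ t := fun ht => by simp [hθ', ht]
  have hθ'0 : θ' 0 = θ₀ := by simp [hθ']
  have hae : ∀ t ∈ Icc 0 T, θ' t =ᵐ[volume] θ t := by
    intro t _
    by_cases ht0 : t = 0
    · subst ht0; rw [hθ'0]; exact h0.symm
    · rw [hθ't ht0]
  exact ⟨θ', hsol.congr_Ioo fun t ht => hθ't ht.1.ne', hL2.congr_ae_slice hae, hθ'0⟩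


/-! ### The degenerate cases `T ≤ 0` and `d = ∅`; the final statement -/

omit [Nonempty d] in
/-- For `T ≤ 0` the time interval `(0,T)` is empty and every admissible test function vanishes at
`t = 0`, so every field is a weak solution on `T^d × [0,T)`. [cite: DiPernaLions1989, §II.1 (12)–(14)] -/
theorem IsWeakScalarTransportDiagOn.of_nonpos (hT : T ≤ 0) (θ : ℝ → UnitAddTorus d → ℝ)
    (hu : AEStronglyMeasurable (stLift u) (volume.restrict (Ioo 0 T ×ˢ univ))) :
    IsWeakScalarTransportDiagOn T a κ u θ₀ θ := by
  have hI : Ioo (0 : ℝ) T = ∅ := Ioo_eq_empty (not_lt.2 hT)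
  have hμ : (volume : Measure ℝ).restrict (Ioo 0 T) = 0 := by rw [hI, Measure.restrict_empty]
  refine ⟨?_, hu, ⟨0, ?_⟩, ?_, ?_, ?_, fun ψ hψ => ?_⟩
  · rw [hI, empty_prod, Measure.restrict_empty]
    exact aestronglyMeasurable_zero_measure _
  · rw [hμ, ae_zero]; exact eventually_bot
  · rw [hμ, lintegral_zero_measure]; exact ENNReal.zero_lt_top
  · rw [hμ, lintegral_zero_measure]; exact ENNReal.zero_lt_top
  · rw [hμ, ae_zero]; exact eventually_bot
  · obtain ⟨T', hT', hψT'⟩ := hψ.2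
    have h0 : ψ 0 = 0 := hψT' 0 (by linarith)
    rw [hμ, integral_zero_measure, h0]
    simp

omit [DecidableEq d] [Nonempty d] in
/-- A field constant in time is trivially the `L²`-continuous representative. [cite: Grafakos2014, Prop. 3.2.7 (3)] -/
theorem isL2ContinuousOn_const_time (hθ₀ : MemLp θ₀ 2 volume) (S : Set ℝ) :
    IsL2ContinuousOn S (fun _ : ℝ => θ₀) := by
  refine ⟨fun _ _ => hθ₀, fun t₀ _ => ?_⟩
  have : (fun t : ℝ => scalarL2Sq ((fun _ : ℝ => θ₀) t - (fun _ : ℝ => θ₀) t₀)) = fun _ => 0 := by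
    funext t; simp [scalarL2Sq]
  rw [this]; exact tendsto_const_nhds

omit [Nonempty d] in
/-- **The degenerate case `d = ∅`**: `T^d` is a point, the velocity pairing and the diffusion vanish,
and the field constant in time equal to `θ₀` is a weak solution (the weak identity reduces to
`θ₀ ∫₀ᵀ ∂ₜψ + θ₀ ψ(0) = 0`). [cite: DiPernaLions1989, §II.1 (12)–(14)] -/
theorem isWeakScalarTransportDiagOn_const_of_isEmpty [IsEmpty d] (hT : 0 < T) (hθ₀ : MemLp θ₀ 2 volume)
    (hu : MemLp (stLift u) ∞ (volume.restrict (Ioo 0 T ×ˢ univ)))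
    (hdiv : ∀ᵐ t ∂((volume : Measure ℝ).restrict (Ioo 0 T)), FunctionSpaces.Torus.IsWeaklyDivFree (u t)) :
    IsWeakScalarTransportDiagOn T a κ u θ₀ (fun _ => θ₀) := by
  haveI : IsFiniteMeasure ((volume : Measure ℝ).restrict (Ioo 0 T)) :=
    isFiniteMeasure_restrict.2 measure_Ioo_lt_top.ne
  -- the velocity is the zero field of the zero-dimensional space
  have hvec : ∀ v : EuclideanSpace ℝ d, v = 0 := fun v => Subsingleton.elim v 0
  have hu0 : ∀ t x, u t x = 0 := fun t x => hvec _
  -- one point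
  have x₀ : UnitAddTorus d := fun i => isEmptyElim i
  have hpt : ∀ f : UnitAddTorus d → ℝ, f = fun _ => f x₀ := fun f =>
    funext fun y => congrArg f (Subsingleton.elim y x₀)
  have hint : ∀ f : UnitAddTorus d → ℝ, ∫ x, f x = f x₀ := fun f => by
    rw [hpt f]; simp
  refine ⟨aestronglyMeasurable_stLift_of_uncurry (S := Ioo 0 T) (u := fun _ : ℝ => θ₀) hθ₀.1.comp_snd, hu.1,
    ⟨(∫⁻ x, ‖θ₀ x‖ₑ ^ 2).toNNReal, ae_of_all _ fun t => ?_⟩, ?_, ?_, hdiv, fun ψ hψ => ?_⟩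
  · rw [ENNReal.coe_toNNReal]
    rw [← FunctionSpaces.eLpNorm_two_pow_two_eq_lintegral]
    exact ENNReal.pow_ne_top hθ₀.eLpNorm_ne_top
  · simp only [hu0, enorm_zero, ne_eq, OfNat.ofNat_ne_zero, not_false_eq_true,
      lintegral_const, zero_mul, ENNReal.zero_lt_top, zero_pow, ENNReal.zero_rpow_of_pos (by norm_num : (0:ℝ) < 1/2)]
  · simp only [hu0, enorm_zero, zero_mul, lintegral_const, ENNReal.zero_lt_top]
  · -- the weak identity
    obtain ⟨T', hT'T, hψ0⟩ := hψ.2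
    have hψT : ψ T = 0 := hψ0 T hT'T.le
    have hder : ∀ t, HasDerivAt (fun τ => ψ τ x₀) (FunctionSpaces.Torus.timeDeriv ψ t x₀) t := by
      intro t
      have h := ((hψ.isSmoothSpaceTimeOn univ).hasDerivWithinAt_slice (mem_univ t) x₀).hasDerivAt univ_mem
      rwa [timeDerivWithin_eq_timeDeriv_of_contDiff hψ.1 uniqueDiffOn_univ (mem_univ t) x₀] at h
    have hcont : Continuous fun t => FunctionSpaces.Torus.timeDeriv ψ t x₀ :=
      continuous_iff_continuousAt.2 fun t =>
        (((hψ.timeDeriv.isSmoothSpaceTimeOn univ).hasDerivWithinAt_slice (mem_univ t) x₀).hasDerivAt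
          univ_mem).continuousAt
    have hFTC : ∫ t in Ioo 0 T, FunctionSpaces.Torus.timeDeriv ψ t x₀ = ψ T x₀ - ψ 0 x₀ := by
      rw [← integral_Ioc_eq_integral_Ioo, ← intervalIntegral.integral_of_le hT.le]
      exact intervalIntegral.integral_eq_sub_of_hasDerivAt (fun t _ => hder t) (hcont.intervalIntegrable _ _)
    have hinner : ∀ t x, θ₀ x * (FunctionSpaces.Torus.timeDeriv ψ t x +
        ⟪u t x, FunctionSpaces.Torus.gradient (ψ t) x⟫_ℝ +
        κ * ∑ i, a i * FunctionSpaces.Torus.partialDeriv i (FunctionSpaces.Torus.partialDeriv i (ψ t)) x) =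
        θ₀ x * FunctionSpaces.Torus.timeDeriv ψ t x := by
      intro t x
      rw [hu0 t x, inner_zero_left, Finset.univ_eq_empty, Finset.sum_empty]
      ring
    simp_rw [hinner]
    have e1 : (∫ t in Ioo 0 T, ∫ x, θ₀ x * FunctionSpaces.Torus.timeDeriv ψ t x) =
        ∫ t in Ioo 0 T, θ₀ x₀ * FunctionSpaces.Torus.timeDeriv ψ t x₀ :=
      setIntegral_congr_fun measurableSet_Ioo fun t _ => hint _
    rw [e1, integral_const_mul, hFTC, hint, hψT]
    simp

omit [Nonempty d] in
/-- **Existence of a strongly `L²`-continuous weak solution of the passive scalar equation with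
constant diagonal diffusion and bounded drift** (the `T2` item of the diag parabolic layer). For
`κ > 0`, coefficients `aᵢ > 0`, an `L²` datum `θ₀` and a bounded measurable velocity field
`u ∈ L^∞((0,T) × T^d)` weakly divergence free at a.e. time, there is a weak solution `θ` of
`∂ₜθ + u·∇θ = κ ∑ᵢ aᵢ ∂ᵢ∂ᵢθ` on `T^d × [0,T)` with datum `θ₀` (`Torus.IsWeakScalarTransportDiagOn T a κ u θ₀ θ`,
the class over which Hess-Childs–Rowan's `[0,√2]×[0,1]`-torus statements quantify, `a = (½,1)`) which
is the `L²`-CONTINUOUS representative on `[0,T]` (`Torus.IsL2ContinuousOn (Icc 0 T) θ`) and has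
`θ 0 = θ₀`. Proof: the mild (Duhamel) solution `𝓕(θ(t))(k) = e^{-νₖt}θ̂₀(k) - ∫₀ᵗe^{-νₖ(t-s)}𝓕(div(uθ))(k)`
constructed by Picard iteration in `L^∞_t ℓ²_k` after exponential damping (Pazy 1983, Ch. 4 §4.2
Def. 2.3, Ch. 6 Thm. 1.2), synthesized by the parametrised Riesz–Fischer theorem, shown to be a weak
solution mode by mode, and strongly continuous by uniform tail control; degenerate cases `T ≤ 0`,
`d = ∅` by the constant field. [cite: Pazy1983, Ch. 4 §4.2 Def. 2.3 and Ch. 6 §6.1 Thm. 1.2, pp. 106, 184] -/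
theorem exists_isWeakScalarTransportDiagOn_l2Continuous {T κ : ℝ} {a : d → ℝ} (hκ : 0 < κ) (ha : ∀ i, 0 < a i)
    {u : ℝ → UnitAddTorus d → EuclideanSpace ℝ d} {θ₀ : UnitAddTorus d → ℝ} (hθ₀ : MemLp θ₀ 2 volume)
    (hu : MemLp (stLift u) ∞ (volume.restrict (Ioo 0 T ×ˢ univ)))
    (hdiv : ∀ᵐ t ∂((volume : Measure ℝ).restrict (Ioo 0 T)), FunctionSpaces.Torus.IsWeaklyDivFree (u t)) :
    ∃ θ : ℝ → UnitAddTorus d → ℝ, IsWeakScalarTransportDiagOn T a κ u θ₀ θ ∧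
      IsL2ContinuousOn (Icc 0 T) θ ∧ θ 0 = θ₀ := by
  rcases le_or_gt T 0 with hT | hT
  · exact ⟨fun _ => θ₀, IsWeakScalarTransportDiagOn.of_nonpos hT _ hu.1, isL2ContinuousOn_const_time hθ₀ _, rfl⟩
  rcases isEmpty_or_nonempty d with hd | hd
  · exact ⟨fun _ => θ₀, isWeakScalarTransportDiagOn_const_of_isEmpty hT hθ₀ hu hdiv,
      isL2ContinuousOn_const_time hθ₀ _, rfl⟩
  · exact exists_isWeakScalarTransportDiagOn_of_pos hT hκ ha hθ₀ hu hdiv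

omit [Nonempty d] in
/-- **Isotropic corollary**: the same for `∂ₜθ + u·∇θ = κΔθ` (`Torus.IsWeakScalarTransportOn`, all
coefficients `1`), i.e. the tree's `exists_isWeakScalarTransportOn` upgraded by the STRONGLY
`L²`-continuous representative with `θ(0) = θ₀`. [cite: Pazy1983, Ch. 4 §4.2 Def. 2.3 and Ch. 6 §6.1 Thm. 1.2, pp. 106, 184] -/
theorem exists_isWeakScalarTransportOn_l2Continuous {T κ : ℝ} (hκ : 0 < κ)
    {u : ℝ → UnitAddTorus d → EuclideanSpace ℝ d} {θ₀ : UnitAddTorus d → ℝ} (hθ₀ : MemLp θ₀ 2 volume)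
    (hu : MemLp (stLift u) ∞ (volume.restrict (Ioo 0 T ×ˢ univ)))
    (hdiv : ∀ᵐ t ∂((volume : Measure ℝ).restrict (Ioo 0 T)), FunctionSpaces.Torus.IsWeaklyDivFree (u t)) :
    ∃ θ : ℝ → UnitAddTorus d → ℝ, IsWeakScalarTransportOn T κ u θ₀ θ ∧
      IsL2ContinuousOn (Icc 0 T) θ ∧ θ 0 = θ₀ := by
  obtain ⟨θ, hθ, hc, h0⟩ := exists_isWeakScalarTransportDiagOn_l2Continuous (a := fun _ : d => (1 : ℝ)) hκ
    (fun _ => one_pos) hθ₀ hu hdiv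
  exact ⟨θ, isWeakScalarTransportDiagOn_one_iff.1 hθ, hc, h0⟩


omit [Nonempty d] in
/-- **Every weak solution has the strongly `L²`-continuous representative.** For `κ > 0`, `aᵢ > 0`,
`θ₀ ∈ L²` and a bounded drift (weak divergence-freeness is part of the class), every weak solution of
`∂ₜθ + u·∇θ = κ∑ᵢaᵢ∂ᵢ∂ᵢθ` on `T^d × [0,T)` agrees at a.e. time with a weak solution which is the
`L²`-continuous representative on `[0,T]` with `θ(0) = θ₀`: existence
(`exists_isWeakScalarTransportDiagOn_l2Continuous`) and uniqueness in `L^∞_t L²_x` for bounded drifts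
(the tree's `Torus.IsWeakScalarTransportDiagOn.ae_eq_of_memLp_top`, Bonicatto–Ciampa–Crippa 2024
Cor. 3.5 in the corner `p = ∞`, `q = 2`). This is the sentence "the unique solution `θ^κ ∈ C([0,T];L²)`"
of the Hess-Childs–Rowan statements, as a theorem about the tree's weak class. [cite: Pazy1983, Ch. 4 §4.2 Def. 2.3 and Ch. 6 §6.1 Thm. 1.2, pp. 106, 184] -/
theorem IsWeakScalarTransportDiagOn.exists_l2Continuous_representative {T κ : ℝ} {a : d → ℝ}
    {u : ℝ → UnitAddTorus d → EuclideanSpace ℝ d} {θ₀ : UnitAddTorus d → ℝ} {θ : ℝ → UnitAddTorus d → ℝ}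
    (hκ : 0 < κ) (ha : ∀ i, 0 < a i) (h : IsWeakScalarTransportDiagOn T a κ u θ₀ θ)
    (hθ₀ : MemLp θ₀ 2 volume) (hu : MemLp (stLift u) ∞ (volume.restrict (Ioo 0 T ×ˢ univ))) :
    ∃ θ' : ℝ → UnitAddTorus d → ℝ, IsWeakScalarTransportDiagOn T a κ u θ₀ θ' ∧
      IsL2ContinuousOn (Icc 0 T) θ' ∧ θ' 0 = θ₀ ∧
      ∀ᵐ t ∂((volume : Measure ℝ).restrict (Ioo 0 T)), θ' t =ᵐ[volume] θ t := by
  obtain ⟨θ', h', hc, h0⟩ := exists_isWeakScalarTransportDiagOn_l2Continuous hκ ha hθ₀ hu h.ae_isWeaklyDivFree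
  exact ⟨θ', h', hc, h0, IsWeakScalarTransportDiagOn.ae_eq_of_memLp_top hκ ha h' h hu⟩

end Existence


end Torus

end Literature.Analysis.FluidPDE

end
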